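import Summits.RiemannHypothesis.RiemannHypothesis.Theorems.PfPersistenceEdgeLawCutoff

/-!
# Edge law by cutting — the pointwise majorant of the archimedean integrand (RH-free)

Part of the pub-rhpf THEORY-2 programme (mechanism / rigidity of the Weil window bottom; no RH
claims). For the steep cutoff `χ = steepCut (a − h) ℓ` (`PfPersistenceEdgeLawCutoff`) and a
normalised ground state `u` (vanishing off `(−a,a)`, pointwise edge law
`‖u y‖² log(1/(a−|y|)) ≤ K_P` near the edges), `cut_pointwise` bounds the archimedean integrand
`ρ(t)(χ(x+t) − χ(x))² |u(x+t)| |u(x)|` of the IMS commutator by zones — NEAR jumps (the deeper end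
at one-sided depth `< R`: both ends obey the pointwise law), FAR SINGULAR jumps (deeper end at
depth `s ∈ [R, r₀]`: `ρ ≤ 1/(2t) + 1` and Young's inequality with the weight `√(L_H/L_s)`,
`L_s = log(1/s)`), FAR BOUNDED jumps (`ρ ≤ ρ(r₀/2)`) — as a sum of correlation products which
`PfPersistenceEdgeLawCutArch` integrates. With `ℓ = κ₂ h`, `R = κ₁ h` this is what makes the
constant of the upper edge law sharp (`2c₀ = 1`).

Sources: E. Bombieri, *Remarks on Weil's quadratic functional in the theory of prime numbers I*,
Rend. Mat. Acc. Lincei (9) 11 (2000) §4; H. Cycon, R. Froese, W. Kirsch, B. Simon, *Schrödinger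
Operators* (1987) Thm 3.2 (IMS localisation).
-/

set_option linter.dupNamespace false

noncomputable section

open MeasureTheory Set Filter
open scoped Topology ENNReal NNReal

namespace Summit.RiemannHypothesis.RiemannHypothesis.Theorems.PfPersistence

open Literature.NumberTheory.LFunctions
open Summit.RiemannHypothesis.RiemannHypothesis.Theorems.WeilWindowFlowWindowLipschitz

set_option maxHeartbeats 800000 in
/-- **Pointwise majorant of the archimedean integrand for the steep cut.** Notation: `H = h + ℓ`,
`L_s = log(1/s)`, `χ = steepCut (a − h) ℓ`, window function `u` vanishing off `(−a, a)` with the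
pointwise edge law `‖u y‖² L_{a−|y|} ≤ K_P` on depths `0 < a − |y| < d₀`; near radius `R` with
`2H ≤ R ≤ r₀ ≤ d₀ < 1`, `2 r₀ ≤ a`; near coefficient `c(t) ≥ ρ(t) min(1, t²/ℓ²)` on `(0, R]`.
Then for `t > 0` and all `x`, `ρ(t)(χ(x+t) − χ(x))² |u(x+t)| |u(x)|` is at most
`c(t)(e(x) + e(x+t)) + V(x) f(x+t) + f(x) V(x+t) + A₁(x+t) B₁(t,x) + A₂(x) B₂(t,x+t)
 + A₃(x) B₃(t,x+t) + A₄(x+t) B₄(t,x)` with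
`e = (K_P/√(L_H L_R)) 1_{a−H<|y|<a}`, `f = |u| 1_{a−H<|y|}`, `V = (1 + ρ(r₀/2)) |u|`,
`A₁ = |u|² 1_{(a−H,a)}`, `B₁(t,y) = 1_{[R,r₀]}(a−y) √L_H/(4t √L_{a−y})`,
`A₂ = |u|² √L_{a−y} 1_{[a−r₀,a−R]}`, `B₂(t,y) = 1_{(a−H,a)}(y)/(4t√L_H)`, and the mirror images
`A₃, B₃, A₄, B₄` at the left edge (`a − y ↦ a + y`). Zones: neither end shallow ⇒ both `χ = 1`;
right end in `(a−H, a)`: by the right-depth `s` of the left end — `s < R` near (both ends obey the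
pointwise law, `(χ−χ)² ≤ min(1,t²/ℓ²)`), `R ≤ s ≤ r₀` far singular (`ρ ≤ 1/(2t)+1`, Young with
weight `√(L_H/L_s)`), `s > r₀` far bounded (`t ≥ r₀/2`, `ρ ≤ ρ(r₀/2)`); left end in
`(−a, −a+H)`: mirror. [folklore] -/
theorem cut_pointwise {u : ℝ → ℂ} {c : ℝ → ℝ} {a h ℓ R r₀ d₀ KP : ℝ}
    (hh : 0 < h) (hℓ : 0 < ℓ) (hHR : 2 * (h + ℓ) ≤ R) (hRr : R ≤ r₀) (hrd : r₀ ≤ d₀) (hd1 : d₀ < 1)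
    (hra : 2 * r₀ ≤ a) (hKP : 0 ≤ KP)
    (hu0 : ∀ x, x ∉ Ioo (-a) a → u x = 0)
    (hP : ∀ x, 0 < a - |x| → a - |x| < d₀ → ‖u x‖ ^ 2 * Real.log (1 / (a - |x|)) ≤ KP)
    (hc0 : ∀ t, 0 ≤ c t) (hc : ∀ t, 0 < t → t ≤ R → weilArchDensity t * min 1 (t ^ 2 / ℓ ^ 2) ≤ c t) :
    ∀ t, 0 < t → ∀ x,
      weilArchDensity t * ((steepCut (a - h) ℓ (x + t) - steepCut (a - h) ℓ x) ^ 2 *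
          (‖u (x + t)‖ * ‖u x‖)) ≤
        c t * ({y : ℝ | a - (h + ℓ) < |y| ∧ |y| < a}.indicator
              (fun _ ↦ KP / Real.sqrt (Real.log (1 / (h + ℓ)) * Real.log (1 / R))) x +
            {y : ℝ | a - (h + ℓ) < |y| ∧ |y| < a}.indicator
              (fun _ ↦ KP / Real.sqrt (Real.log (1 / (h + ℓ)) * Real.log (1 / R))) (x + t)) +
        (1 + weilArchDensity (r₀ / 2)) * ‖u x‖ *
            {y : ℝ | a - (h + ℓ) < |y|}.indicator (fun y ↦ ‖u y‖) (x + t) +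
        {y : ℝ | a - (h + ℓ) < |y|}.indicator (fun y ↦ ‖u y‖) x *
            ((1 + weilArchDensity (r₀ / 2)) * ‖u (x + t)‖) +
        (Ioo (a - (h + ℓ)) a).indicator (fun y ↦ ‖u y‖ ^ 2) (x + t) *
            (Icc R r₀).indicator (fun s ↦ Real.sqrt (Real.log (1 / (h + ℓ))) /
              (4 * t * Real.sqrt (Real.log (1 / s)))) (a - x) +
        (Icc (a - r₀) (a - R)).indicator
              (fun y ↦ ‖u y‖ ^ 2 * Real.sqrt (Real.log (1 / (a - y)))) x *
            ((Ioo (a - (h + ℓ)) a).indicator 1 (x + t) /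
              (4 * t * Real.sqrt (Real.log (1 / (h + ℓ))))) +
        (Ioo (-a) (-a + (h + ℓ))).indicator (fun y ↦ ‖u y‖ ^ 2) x *
            (Icc R r₀).indicator (fun s ↦ Real.sqrt (Real.log (1 / (h + ℓ))) /
              (4 * t * Real.sqrt (Real.log (1 / s)))) (a + (x + t)) +
        (Icc (-a + R) (-a + r₀)).indicator
              (fun y ↦ ‖u y‖ ^ 2 * Real.sqrt (Real.log (1 / (a + y)))) (x + t) *
            ((Ioo (-a) (-a + (h + ℓ))).indicator 1 x /
              (4 * t * Real.sqrt (Real.log (1 / (h + ℓ))))) := by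
  intro t ht x
  -- abbreviations
  set H : ℝ := h + ℓ with hHdef
  set LH : ℝ := Real.log (1 / H) with hLH
  set LR : ℝ := Real.log (1 / R) with hLR
  set χ : ℝ → ℝ := steepCut (a - h) ℓ with hχ
  set e0 : ℝ := KP / Real.sqrt (LH * LR) with he0
  set cV : ℝ := 1 + weilArchDensity (r₀ / 2) with hcV
  have hH : 0 < H := by positivity
  have hHR' : H < R := by linarith
  have hR1 : R < 1 := by linarith
  have hr1 : r₀ < 1 := by linarith
  have hH1 : H < 1 := by linarith
  have hHa : H < a := by linarith
  have hLHpos : 0 < LH := stub_surplusReduction_log_pos hH hH1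
  have hLRpos : 0 < LR := stub_surplusReduction_log_pos (hH.trans hHR') hR1
  have hLHR : LR ≤ LH := by
    rw [hLR, hLH, one_div, Real.log_inv, one_div, Real.log_inv, neg_le_neg_iff]
    exact Real.log_le_log hH hHR'.le
  have he0nn : 0 ≤ e0 := by positivity
  have hρ0 : 0 ≤ weilArchDensity t := (weilArchDensity_pos ht).le
  have hρr : 0 < weilArchDensity (r₀ / 2) := weilArchDensity_pos (by linarith)
  have hcV1 : 1 ≤ cV := by linarith
  have hχ01 := steepCut_mem (a - h) ℓ
  have hsq1 : (χ (x + t) - χ x) ^ 2 ≤ 1 :=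
    (sq_steepCut_sub_le hℓ (x + t) x).trans (min_le_left _ _)
  have hsqt : (χ (x + t) - χ x) ^ 2 ≤ min 1 (t ^ 2 / ℓ ^ 2) := by
    simpa using sq_steepCut_sub_le (b := a - h) hℓ (x + t) x
  have hsq0 : 0 ≤ (χ (x + t) - χ x) ^ 2 := sq_nonneg _
  -- every summand of the right-hand side is non-negative
  have hind0 : ∀ (S : Set ℝ) (g : ℝ → ℝ) (y : ℝ), (∀ z, 0 ≤ g z) → 0 ≤ S.indicator g y :=
    fun S g y hg ↦ indicator_nonneg (fun z _ ↦ hg z) y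
  have hB0 : ∀ s, 0 ≤ Real.sqrt LH / (4 * t * Real.sqrt (Real.log (1 / s))) := fun s ↦ by positivity
  have hT1 : 0 ≤ c t * ({y : ℝ | a - H < |y| ∧ |y| < a}.indicator (fun _ ↦ e0) x +
      {y : ℝ | a - H < |y| ∧ |y| < a}.indicator (fun _ ↦ e0) (x + t)) :=
    mul_nonneg (hc0 t) (add_nonneg (hind0 _ _ _ fun _ ↦ he0nn) (hind0 _ _ _ fun _ ↦ he0nn))
  have hT2 : 0 ≤ cV * ‖u x‖ * {y : ℝ | a - H < |y|}.indicator (fun y ↦ ‖u y‖) (x + t) :=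
    mul_nonneg (by positivity) (hind0 _ _ _ fun _ ↦ norm_nonneg _)
  have hT3 : 0 ≤ {y : ℝ | a - H < |y|}.indicator (fun y ↦ ‖u y‖) x * (cV * ‖u (x + t)‖) :=
    mul_nonneg (hind0 _ _ _ fun _ ↦ norm_nonneg _) (by positivity)
  have hT4 : 0 ≤ (Ioo (a - H) a).indicator (fun y ↦ ‖u y‖ ^ 2) (x + t) *
      (Icc R r₀).indicator (fun s ↦ Real.sqrt LH / (4 * t * Real.sqrt (Real.log (1 / s)))) (a - x) :=
    mul_nonneg (hind0 _ _ _ fun _ ↦ by positivity) (hind0 _ _ _ hB0)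
  have hT5 : 0 ≤ (Icc (a - r₀) (a - R)).indicator
      (fun y ↦ ‖u y‖ ^ 2 * Real.sqrt (Real.log (1 / (a - y)))) x *
      ((Ioo (a - H) a).indicator 1 (x + t) / (4 * t * Real.sqrt LH)) :=
    mul_nonneg (hind0 _ _ _ fun _ ↦ by positivity)
      (div_nonneg (hind0 _ _ _ fun _ ↦ zero_le_one) (by positivity))
  have hT6 : 0 ≤ (Ioo (-a) (-a + H)).indicator (fun y ↦ ‖u y‖ ^ 2) x *
      (Icc R r₀).indicator (fun s ↦ Real.sqrt LH / (4 * t * Real.sqrt (Real.log (1 / s))))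
        (a + (x + t)) :=
    mul_nonneg (hind0 _ _ _ fun _ ↦ by positivity) (hind0 _ _ _ hB0)
  have hT7 : 0 ≤ (Icc (-a + R) (-a + r₀)).indicator
      (fun y ↦ ‖u y‖ ^ 2 * Real.sqrt (Real.log (1 / (a + y)))) (x + t) *
      ((Ioo (-a) (-a + H)).indicator 1 x / (4 * t * Real.sqrt LH)) :=
    mul_nonneg (hind0 _ _ _ fun _ ↦ by positivity)
      (div_nonneg (hind0 _ _ _ fun _ ↦ zero_le_one) (by positivity))
  -- trivial cases: an end vanishes
  by_cases hup : u (x + t) = 0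
  · rw [hup, norm_zero, zero_mul, mul_zero, mul_zero]
    linarith
  by_cases huq : u x = 0
  · rw [huq, norm_zero, mul_zero, mul_zero, mul_zero]
    linarith
  have hpI : x + t ∈ Ioo (-a) a := by
    by_contra hcon
    exact hup (hu0 _ hcon)
  have hqI : x ∈ Ioo (-a) a := by
    by_contra hcon
    exact huq (hu0 _ hcon)
  have hnp : 0 ≤ ‖u (x + t)‖ := norm_nonneg _
  have hnq : 0 ≤ ‖u x‖ := norm_nonneg _
  -- the bounded-part inequality `|u p| |u q| ≤ f · V` in both orientations
  have hLHS0 : weilArchDensity t * ((χ (x + t) - χ x) ^ 2 * (‖u (x + t)‖ * ‖u x‖)) ≤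
      weilArchDensity t * (‖u (x + t)‖ * ‖u x‖) := by
    refine mul_le_mul_of_nonneg_left ?_ hρ0
    calc (χ (x + t) - χ x) ^ 2 * (‖u (x + t)‖ * ‖u x‖) ≤ 1 * (‖u (x + t)‖ * ‖u x‖) :=
        mul_le_mul_of_nonneg_right hsq1 (by positivity)
      _ = _ := one_mul _
  by_cases hpR : x + t ∈ Ioo (a - H) a
  · -- the right end is shallow at the right edge
    have hp0 : 0 < x + t := by linarith [hpR.1]
    have hdp : 0 < a - (x + t) := by linarith [hpR.2]
    have hdpH : a - (x + t) < H := by linarith [hpR.1]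
    have hdepp : a - |x + t| = a - (x + t) := by rw [abs_of_pos hp0]
    have hfp : {y : ℝ | a - H < |y|}.indicator (fun y ↦ ‖u y‖) (x + t) = ‖u (x + t)‖ :=
      indicator_of_mem (show x + t ∈ {y : ℝ | a - H < |y|} by
        rw [mem_setOf_eq, abs_of_pos hp0]; exact hpR.1) _
    -- the right-depth of the left end
    set s : ℝ := a - x with hs
    have hst : s = a - (x + t) + t := by rw [hs]; ring
    rcases lt_or_ge s R with hsR | hsR
    · -- NEAR
      have htR : t < R := by linarith
      have hep : {y : ℝ | a - H < |y| ∧ |y| < a}.indicator (fun _ ↦ e0) (x + t) = e0 :=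
        indicator_of_mem (show x + t ∈ {y : ℝ | a - H < |y| ∧ |y| < a} by
          rw [mem_setOf_eq, abs_of_pos hp0]; exact ⟨hpR.1, hpR.2⟩) _
      have hex : 0 ≤ {y : ℝ | a - H < |y| ∧ |y| < a}.indicator (fun _ ↦ e0) x :=
        hind0 _ _ _ fun _ ↦ he0nn
      -- pointwise law at both ends
      have hup' : ‖u (x + t)‖ ≤ Real.sqrt (KP / LH) := by
        refine norm_le_sqrt_div_log (hP _ (by rw [hdepp]; exact hdp)
          (by rw [hdepp]; linarith)) (by rw [hdepp]; exact hdp) (by rw [hdepp]; exact hdpH.le) hH1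
      have hdq0 : 0 < a - |x| := by
        have : |x| < a := abs_lt.2 ⟨hqI.1, hqI.2⟩
        linarith
      have hdqs : a - |x| ≤ s := by rw [hs]; linarith [le_abs_self x]
      have huq' : ‖u x‖ ≤ Real.sqrt (KP / LR) :=
        norm_le_sqrt_div_log (hP _ hdq0 (by linarith)) hdq0 (hdqs.trans hsR.le) hR1
      have hprod : ‖u (x + t)‖ * ‖u x‖ ≤ e0 := by
        calc ‖u (x + t)‖ * ‖u x‖ ≤ Real.sqrt (KP / LH) * Real.sqrt (KP / LR) :=
            mul_le_mul hup' huq' hnq (Real.sqrt_nonneg _)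
          _ = e0 := by
              rw [he0, ← Real.sqrt_mul (by positivity), div_mul_div_comm, ← sq,
                Real.sqrt_div (sq_nonneg KP), Real.sqrt_sq hKP]
      have hmain : weilArchDensity t * ((χ (x + t) - χ x) ^ 2 * (‖u (x + t)‖ * ‖u x‖)) ≤
          c t * e0 := by
        calc _ = (weilArchDensity t * (χ (x + t) - χ x) ^ 2) * (‖u (x + t)‖ * ‖u x‖) := by ring
          _ ≤ (weilArchDensity t * min 1 (t ^ 2 / ℓ ^ 2)) * e0 :=
              mul_le_mul (mul_le_mul_of_nonneg_left hsqt hρ0) hprod (by positivity)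
                (mul_nonneg hρ0 (le_min zero_le_one (by positivity)))
          _ ≤ c t * e0 := mul_le_mul_of_nonneg_right (hc t ht htR.le) he0nn
      rw [hep]
      have hcEX := mul_nonneg (hc0 t) hex
      linarith [hmain, hcEX, hT2, hT3, hT4, hT5, hT6, hT7]
    rcases le_or_gt s r₀ with hsr | hsr
    · -- FAR SINGULAR: `R ≤ s ≤ r₀`
      have hx0 : 0 < x := by rw [hs] at hsr; linarith
      have hxabs : |x| = x := abs_of_pos hx0
      have ht1 : t ≤ 1 := by linarith
      have hρ := abs_weilArchDensity_sub_le ht ht1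
      rw [abs_le] at hρ
      have hρ' : weilArchDensity t ≤ 1 / (2 * t) + 1 := by linarith [hρ.2]
      have hLs : 0 < Real.log (1 / s) := stub_surplusReduction_log_pos (by linarith) (by linarith)
      set α : ℝ := Real.sqrt LH / Real.sqrt (Real.log (1 / s)) with hα
      have hα0 : 0 < α := by positivity
      have hyoung := mul_div_two_mul_le_young (P := ‖u (x + t)‖) (Q := ‖u x‖) hα0 ht
      -- identify the four products
      have hA1 : (Ioo (a - H) a).indicator (fun y ↦ ‖u y‖ ^ 2) (x + t) = ‖u (x + t)‖ ^ 2 :=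
        indicator_of_mem hpR _
      have hB1 : (Icc R r₀).indicator (fun s ↦ Real.sqrt LH / (4 * t * Real.sqrt (Real.log (1 / s))))
          (a - x) = Real.sqrt LH / (4 * t * Real.sqrt (Real.log (1 / s))) := by
        rw [← hs, indicator_of_mem (show s ∈ Icc R r₀ from ⟨hsR, hsr⟩)]
      have hA2 : (Icc (a - r₀) (a - R)).indicator
          (fun y ↦ ‖u y‖ ^ 2 * Real.sqrt (Real.log (1 / (a - y)))) x =
          ‖u x‖ ^ 2 * Real.sqrt (Real.log (1 / s)) := by
        rw [indicator_of_mem (show x ∈ Icc (a - r₀) (a - R) by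
          rw [hs] at hsR hsr; exact ⟨by linarith, by linarith⟩)]
      have hB2 : (Ioo (a - H) a).indicator (1 : ℝ → ℝ) (x + t) / (4 * t * Real.sqrt LH) =
          1 / (4 * t * Real.sqrt LH) := by
        rw [indicator_of_mem hpR, Pi.one_apply]
      have hsing : ‖u (x + t)‖ * ‖u x‖ / (2 * t) ≤
          ‖u (x + t)‖ ^ 2 * (Real.sqrt LH / (4 * t * Real.sqrt (Real.log (1 / s)))) +
          ‖u x‖ ^ 2 * Real.sqrt (Real.log (1 / s)) * (1 / (4 * t * Real.sqrt LH)) := by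
        refine hyoung.trans (le_of_eq ?_)
        rw [hα]
        have h1 : Real.sqrt LH ≠ 0 := (Real.sqrt_pos.2 hLHpos).ne'
        have h2 : Real.sqrt (Real.log (1 / s)) ≠ 0 := (Real.sqrt_pos.2 hLs).ne'
        field_simp
      have hbdd : ‖u (x + t)‖ * ‖u x‖ ≤
          cV * ‖u x‖ * {y : ℝ | a - H < |y|}.indicator (fun y ↦ ‖u y‖) (x + t) := by
        rw [hfp]
        nlinarith [mul_nonneg hnp hnq, hcV1]
      have hmain : weilArchDensity t * ((χ (x + t) - χ x) ^ 2 * (‖u (x + t)‖ * ‖u x‖)) ≤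
          ‖u (x + t)‖ * ‖u x‖ / (2 * t) + ‖u (x + t)‖ * ‖u x‖ := by
        refine hLHS0.trans ?_
        calc weilArchDensity t * (‖u (x + t)‖ * ‖u x‖) ≤ (1 / (2 * t) + 1) * (‖u (x + t)‖ * ‖u x‖) :=
            mul_le_mul_of_nonneg_right hρ' (by positivity)
          _ = _ := by ring
      rw [hA1, hB1, hA2, hB2]
      linarith [hsing, hbdd, hmain, hT1, hT3, hT6, hT7]
    · -- FAR BOUNDED: `s > r₀`, so `t ≥ r₀/2`
      have htr : r₀ / 2 ≤ t := by linarith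
      have hρ' : weilArchDensity t ≤ weilArchDensity (r₀ / 2) :=
        weilArchDensity_antitoneOn (mem_Ioi.2 (by linarith)) (mem_Ioi.2 ht) htr
      have hmain : weilArchDensity t * ((χ (x + t) - χ x) ^ 2 * (‖u (x + t)‖ * ‖u x‖)) ≤
          cV * ‖u x‖ * {y : ℝ | a - H < |y|}.indicator (fun y ↦ ‖u y‖) (x + t) := by
        rw [hfp]
        refine hLHS0.trans ?_
        calc weilArchDensity t * (‖u (x + t)‖ * ‖u x‖) ≤ cV * (‖u (x + t)‖ * ‖u x‖) :=
            mul_le_mul_of_nonneg_right (by linarith) (by positivity)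
          _ = _ := by ring
      linarith [hmain, hT1, hT3, hT4, hT5, hT6, hT7]
  by_cases hqL : x ∈ Ioo (-a) (-a + H)
  · -- the left end is shallow at the left edge
    have hq0 : x < 0 := by linarith [hqL.2]
    have hdq : 0 < a + x := by linarith [hqL.1]
    have hdqH : a + x < H := by linarith [hqL.2]
    have hdepq : a - |x| = a + x := by rw [abs_of_neg hq0]; ring
    have hfq : {y : ℝ | a - H < |y|}.indicator (fun y ↦ ‖u y‖) x = ‖u x‖ :=
      indicator_of_mem (show x ∈ {y : ℝ | a - H < |y|} by
        rw [mem_setOf_eq, abs_of_neg hq0]; linarith) _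
    set s : ℝ := a + (x + t) with hs
    have hst : s = a + x + t := by rw [hs]; ring
    rcases lt_or_ge s R with hsR | hsR
    · -- NEAR
      have htR : t < R := by linarith
      have heq' : {y : ℝ | a - H < |y| ∧ |y| < a}.indicator (fun _ ↦ e0) x = e0 :=
        indicator_of_mem (show x ∈ {y : ℝ | a - H < |y| ∧ |y| < a} by
          rw [mem_setOf_eq, abs_of_neg hq0]; exact ⟨by linarith, by linarith [hqI.1]⟩) _
      have hex : 0 ≤ {y : ℝ | a - H < |y| ∧ |y| < a}.indicator (fun _ ↦ e0) (x + t) :=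
        hind0 _ _ _ fun _ ↦ he0nn
      have huq' : ‖u x‖ ≤ Real.sqrt (KP / LH) :=
        norm_le_sqrt_div_log (hP _ (by rw [hdepq]; exact hdq) (by rw [hdepq]; linarith))
          (by rw [hdepq]; exact hdq) (by rw [hdepq]; exact hdqH.le) hH1
      have hdp0 : 0 < a - |x + t| := by
        have : |x + t| < a := abs_lt.2 ⟨hpI.1, hpI.2⟩
        linarith
      have hdps : a - |x + t| ≤ s := by rw [hs]; linarith [neg_abs_le (x + t)]
      have hup' : ‖u (x + t)‖ ≤ Real.sqrt (KP / LR) :=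
        norm_le_sqrt_div_log (hP _ hdp0 (by linarith)) hdp0 (hdps.trans hsR.le) hR1
      have hprod : ‖u (x + t)‖ * ‖u x‖ ≤ e0 := by
        calc ‖u (x + t)‖ * ‖u x‖ ≤ Real.sqrt (KP / LR) * Real.sqrt (KP / LH) :=
            mul_le_mul hup' huq' hnq (Real.sqrt_nonneg _)
          _ = Real.sqrt (KP / LH) * Real.sqrt (KP / LR) := mul_comm _ _
          _ = e0 := by
              rw [he0, ← Real.sqrt_mul (by positivity), div_mul_div_comm, ← sq,
                Real.sqrt_div (sq_nonneg KP), Real.sqrt_sq hKP]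
      have hmain : weilArchDensity t * ((χ (x + t) - χ x) ^ 2 * (‖u (x + t)‖ * ‖u x‖)) ≤
          c t * e0 := by
        calc _ = (weilArchDensity t * (χ (x + t) - χ x) ^ 2) * (‖u (x + t)‖ * ‖u x‖) := by ring
          _ ≤ (weilArchDensity t * min 1 (t ^ 2 / ℓ ^ 2)) * e0 :=
              mul_le_mul (mul_le_mul_of_nonneg_left hsqt hρ0) hprod (by positivity)
                (mul_nonneg hρ0 (le_min zero_le_one (by positivity)))
          _ ≤ c t * e0 := mul_le_mul_of_nonneg_right (hc t ht htR.le) he0nn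
      rw [heq']
      have hcEX := mul_nonneg (hc0 t) hex
      linarith [hmain, hcEX, hT2, hT3, hT4, hT5, hT6, hT7]
    rcases le_or_gt s r₀ with hsr | hsr
    · -- FAR SINGULAR (left edge)
      have hp0 : x + t < 0 := by rw [hs] at hsr; linarith
      have ht1 : t ≤ 1 := by linarith
      have hρ := abs_weilArchDensity_sub_le ht ht1
      rw [abs_le] at hρ
      have hρ' : weilArchDensity t ≤ 1 / (2 * t) + 1 := by linarith [hρ.2]
      have hLs : 0 < Real.log (1 / s) := stub_surplusReduction_log_pos (by linarith) (by linarith)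
      set α : ℝ := Real.sqrt LH / Real.sqrt (Real.log (1 / s)) with hα
      have hα0 : 0 < α := by positivity
      have hyoung := mul_div_two_mul_le_young (P := ‖u x‖) (Q := ‖u (x + t)‖) hα0 ht
      have hA3 : (Ioo (-a) (-a + H)).indicator (fun y ↦ ‖u y‖ ^ 2) x = ‖u x‖ ^ 2 :=
        indicator_of_mem hqL _
      have hB3 : (Icc R r₀).indicator (fun s ↦ Real.sqrt LH / (4 * t * Real.sqrt (Real.log (1 / s))))
          (a + (x + t)) = Real.sqrt LH / (4 * t * Real.sqrt (Real.log (1 / s))) := by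
        rw [← hs, indicator_of_mem (show s ∈ Icc R r₀ from ⟨hsR, hsr⟩)]
      have hA4 : (Icc (-a + R) (-a + r₀)).indicator
          (fun y ↦ ‖u y‖ ^ 2 * Real.sqrt (Real.log (1 / (a + y)))) (x + t) =
          ‖u (x + t)‖ ^ 2 * Real.sqrt (Real.log (1 / s)) := by
        rw [indicator_of_mem (show x + t ∈ Icc (-a + R) (-a + r₀) by
          rw [hs] at hsR hsr; exact ⟨by linarith, by linarith⟩)]
      have hB4 : (Ioo (-a) (-a + H)).indicator (1 : ℝ → ℝ) x / (4 * t * Real.sqrt LH) =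
          1 / (4 * t * Real.sqrt LH) := by
        rw [indicator_of_mem hqL, Pi.one_apply]
      have hsing : ‖u x‖ * ‖u (x + t)‖ / (2 * t) ≤
          ‖u x‖ ^ 2 * (Real.sqrt LH / (4 * t * Real.sqrt (Real.log (1 / s)))) +
          ‖u (x + t)‖ ^ 2 * Real.sqrt (Real.log (1 / s)) * (1 / (4 * t * Real.sqrt LH)) := by
        refine hyoung.trans (le_of_eq ?_)
        rw [hα]
        have h1 : Real.sqrt LH ≠ 0 := (Real.sqrt_pos.2 hLHpos).ne'
        have h2 : Real.sqrt (Real.log (1 / s)) ≠ 0 := (Real.sqrt_pos.2 hLs).ne'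
        field_simp
      have hbdd : ‖u (x + t)‖ * ‖u x‖ ≤
          {y : ℝ | a - H < |y|}.indicator (fun y ↦ ‖u y‖) x * (cV * ‖u (x + t)‖) := by
        rw [hfq]
        nlinarith [mul_nonneg hnp hnq, hcV1]
      have hmain : weilArchDensity t * ((χ (x + t) - χ x) ^ 2 * (‖u (x + t)‖ * ‖u x‖)) ≤
          ‖u x‖ * ‖u (x + t)‖ / (2 * t) + ‖u (x + t)‖ * ‖u x‖ := by
        refine hLHS0.trans ?_
        calc weilArchDensity t * (‖u (x + t)‖ * ‖u x‖) ≤ (1 / (2 * t) + 1) * (‖u (x + t)‖ * ‖u x‖) :=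
            mul_le_mul_of_nonneg_right hρ' (by positivity)
          _ = _ := by ring
      rw [hA3, hB3, hA4, hB4]
      linarith [hsing, hbdd, hmain, hT1, hT2, hT4, hT5]
    · -- FAR BOUNDED (left edge)
      have htr : r₀ / 2 ≤ t := by linarith
      have hρ' : weilArchDensity t ≤ weilArchDensity (r₀ / 2) :=
        weilArchDensity_antitoneOn (mem_Ioi.2 (by linarith)) (mem_Ioi.2 ht) htr
      have hmain : weilArchDensity t * ((χ (x + t) - χ x) ^ 2 * (‖u (x + t)‖ * ‖u x‖)) ≤
          {y : ℝ | a - H < |y|}.indicator (fun y ↦ ‖u y‖) x * (cV * ‖u (x + t)‖) := by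
        rw [hfq]
        refine hLHS0.trans ?_
        calc weilArchDensity t * (‖u (x + t)‖ * ‖u x‖) ≤ cV * (‖u (x + t)‖ * ‖u x‖) :=
            mul_le_mul_of_nonneg_right (by linarith) (by positivity)
          _ = _ := by ring
      linarith [hmain, hT1, hT2, hT4, hT5, hT6, hT7]
  · -- neither end is shallow: both cutoff values are `1`
    have hp1 : χ (x + t) = 1 := by
      refine steepCut_eq_one hℓ (abs_le.2 ⟨?_, ?_⟩)
      · have : -a + H ≤ x := by
          rcases not_and_or.1 (show ¬(-a < x ∧ x < -a + H) from hqL) with h1 | h1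
          · exact absurd hqI.1 h1
          · linarith
        linarith
      · rcases not_and_or.1 (show ¬(a - H < x + t ∧ x + t < a) from hpR) with h1 | h1
        · linarith
        · exact absurd hpI.2 h1
    have hq1 : χ x = 1 := by
      refine steepCut_eq_one hℓ (abs_le.2 ⟨?_, ?_⟩)
      · rcases not_and_or.1 (show ¬(-a < x ∧ x < -a + H) from hqL) with h1 | h1
        · exact absurd hqI.1 h1
        · linarith
      · have : x + t ≤ a - H := by
          rcases not_and_or.1 (show ¬(a - H < x + t ∧ x + t < a) from hpR) with h1 | h1
          · linarith
          · exact absurd hpI.2 h1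
        linarith
    rw [hp1, hq1, sub_self, zero_pow two_ne_zero, zero_mul, mul_zero]
    linarith [hT1, hT2, hT3, hT4, hT5, hT6, hT7]

end Summit.RiemannHypothesis.RiemannHypothesis.Theorems.PfPersistence

end
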